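import Summits.HodgeConjecture.HodgeConjecture.Theorems.AmpleAdicLefschetzSectionalSourceStubSupply
import HarnessLib

/-!
# Crux `SectionalSource` (stmt-HodgeConjecture-10725), line `birth` — stub `stub_iteratedSupply`

ITERATED BERTINI SUPPLY: SMOOTH LINEAR SECTIONS OF ANY CODIMENSION WITH AMBIENT AFFINE COMPLEMENT
PIECES. For `X` smooth projective of dimension `n` over `ℂ` and `1 ≤ k ≤ n − 1` there are a smooth
projective `Y` of dimension `n − k`, a closed immersion `f : Y ⟶ X` with `X ∖ f(Y)` non-empty, and a
set `s` of at most `k` AFFINE opens of `X` covering exactly `X ∖ f(Y)` (`stub_iteratedSupply`).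

Proof. Fix ONE closed immersion `ι : X ↪ ℙᴺ` (`IsSmoothProjective.isProjectiveOver`) and induct on
`k` with the invariant "the complement of `f(Y)` is a union of at most `k` ambient basic opens
`X ∩ D₊(ℓ) = ι⁻¹ D₊(ℓ)` (`Resolution.LinSec.XL (ιPP ι) v`)" (`exists_linearSection_basicOpens`):

* one step with a GIVEN embedding `j : Y ↪ ℙᴺ` of a smooth projective `Y` of dimension
  `m + 1 ≥ 2` (`exists_hyperplaneSection_of_embedding`, the pencil step of the landed
  `stub_supply_of_two_le`): a good pencil of hyperplane sections `a = (a₀, a₁)`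
  (`exists_goodPencil`), a complex point `s = [w]` of `ℙ¹` off its discriminant, the smooth member
  `Y' = π⁻¹(s)` of dimension `m` with the closed immersion `u_s : π⁻¹(s) ⟶ Ỹ ⟶ Y`
  (`isClosedImmersion_fiberι_blowDown_left`) whose image is the hyperplane section
  `Y ∩ V₊(w₁ a₀ − w₀ a₁)` (`range_fiberι_blowDown_base_eq_hyp`);
* the step `k → k + 1` applies it to the composite embedding `Y ↪ X ↪ ℙᴺ`, along which the basic
  opens pull back (`XL_ιPP_comp`: `(Y ∩ D₊(ℓ)) = f⁻¹(X ∩ D₊(ℓ))`), so that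
  `X ∖ f(u_s(Y')) = (X ∖ f(Y)) ∪ (X ∩ D₊(ℓ))`;
* finally the basic opens are affine (`Resolution.LinSec.isAffineOpen_XL`: closed in the affine
  `D₊(ℓ)`), and the complement is non-empty because a surjective closed immersion from the
  `(n − k)`-fold `Y` onto the `n`-fold `X` would be a homeomorphism
  (`eq_of_isSmoothProjective_of_isHomeomorph`).

## References

* [Hartshorne1977] R. Hartshorne, Algebraic Geometry (1977), II Prop. 2.5, II Thm. 8.18,
  III Cor. 7.9, II Ex. 3.20.
* [VoisinHodgeII2003] C. Voisin, Hodge Theory and Complex Algebraic Geometry II (2003), §2.1.1.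
-/

noncomputable section

-- mandated namespace `Summit.HodgeConjecture.HodgeConjecture.Theorems` (single-problem summit: Problem =
-- Summit) trips `linter.dupNamespace`; off tree-wide in the lakefile, restated for stand-alone elaboration.
set_option linter.dupNamespace false

namespace Summit.HodgeConjecture.HodgeConjecture.Theorems

open CategoryTheory AlgebraicGeometry
open Literature.AlgebraicGeometry Literature.AlgebraicGeometry.Motives
open Literature.AlgebraicGeometry.Motives.LinearSectionNet
open Literature.AlgebraicGeometry.HodgeTheory

attribute [local instance] MvPolynomial.gradedAlgebra

/-! ## One pencil step along a given embedding -/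

/-- **One smooth hyperplane section along a GIVEN embedding.** For `Y` smooth projective of
dimension `m + 1 ≥ 2` over `ℂ` and a closed immersion `j : Y ⟶ ℙᴺ` there are a smooth projective
`Y'` of dimension `m`, a closed immersion `f' : Y' ⟶ Y` and a linear form `ℓ = Σ v_c x_c` with
`f'(Y') = Y ∩ V₊(ℓ)` set-theoretically: a smooth member `π⁻¹(s)` of a good pencil of hyperplane
sections (`exists_goodPencil`) over a complex point `s = [w]` of `ℙ¹` off the discriminant, through
the blow-down (`isClosedImmersion_fiberι_blowDown_left`, `range_fiberι_blowDown_base_eq_hyp`).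
Verbatim the pencil step of `stub_supply_of_two_le`, with the embedding as a parameter.
[cite: Hartshorne1977, II Thm. 8.18 and III Cor. 7.9] [cite: VoisinHodgeII2003, §2.1.1] -/
theorem exists_hyperplaneSection_of_embedding {m N : ℕ} {Y : SchemeOver ℂ}
    (hY : IsSmoothProjective (m + 1) Y) (hm : 1 ≤ m) (j : Y ⟶ projectiveSpace N ℂ)
    [IsClosedImmersion j.left] :
    ∃ (Y' : SchemeOver ℂ) (f' : Y' ⟶ Y) (v : Fin (N + 1) → ℂ),
      IsSmoothProjective m Y' ∧ IsClosedImmersion f'.left ∧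
        Set.range f'.left.base = Resolution.LinSec.hyp (ιPP j) v := by
  obtain ⟨a, -, -, T, hTc, hTne, hfib⟩ := exists_goodPencil hY j hm
  -- a complex point `s = [w]` of `ℙ¹` off the discriminant `T`
  haveI : LocallyOfFiniteType (projectiveSpace 1 ℂ).hom :=
    haveI : IsProper (projectiveSpace 1 ℂ).hom := isProper_projectiveSpace 1 ℂ
    inferInstance
  obtain ⟨s, hs⟩ := ComplexPoints.exists_pt_mem (X := projectiveSpace 1 ℂ) (Z := Tᶜ)
    (Set.nonempty_compl.2 hTne) hTc.isOpen_compl.isLocallyClosed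
  obtain ⟨w, hw, rfl⟩ := ProjectiveSpace.exists_eq_pointOfVec s
  haveI hf := isClosedImmersion_fiberι_blowDown_left j a (ProjectiveSpace.pointOfVec ℂ w hw)
  haveI : LocallyOfFiniteType Y.hom := by
    haveI := hY.smoothOfRelativeDimension
    haveI : Smooth Y.hom := SmoothOfRelativeDimension.smooth (m + 1) Y.hom
    infer_instance
  exact ⟨fiberOver (proj j a) (ProjectiveSpace.pointOfVec ℂ w hw),
    fiberι (proj j a) (ProjectiveSpace.pointOfVec ℂ w hw) ≫ blowDown j a,
    fun c ↦ w 1 * a 0 c - w 0 * a 1 c, hfib _ hs, hf, range_fiberι_blowDown_base_eq_hyp j a w hw⟩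

/-! ## Basic opens of the ambient `ℙᴺ` pull back along `Y ⟶ X ⟶ ℙᴺ` -/

/-- The basic open `Y ∩ D₊(ℓ)` of `Y` for the composite embedding `Y ⟶ X ⟶ ℙᴺ` is the preimage of
the basic open `X ∩ D₊(ℓ)` of `X` (preimages compose). [folklore] -/
theorem XL_ιPP_comp {N : ℕ} {Y X : SchemeOver ℂ} (f : Y ⟶ X) (ι : X ⟶ projectiveSpace N ℂ)
    (v : Fin (N + 1) → ℂ) :
    Resolution.LinSec.XL (ιPP (f ≫ ι)) v = f.left ⁻¹ᵁ Resolution.LinSec.XL (ιPP ι) v :=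
  rfl

/-- The hyperplane section `Y ∩ V₊(ℓ)` of `Y` for the composite embedding `Y ⟶ X ⟶ ℙᴺ` is the
preimage of the hyperplane section `X ∩ V₊(ℓ)` of `X`. [folklore] -/
theorem hyp_ιPP_comp {N : ℕ} {Y X : SchemeOver ℂ} (f : Y ⟶ X) (ι : X ⟶ projectiveSpace N ℂ)
    (v : Fin (N + 1) → ℂ) :
    Resolution.LinSec.hyp (ιPP (f ≫ ι)) v = f.left.base ⁻¹' Resolution.LinSec.hyp (ιPP ι) v :=
  rfl

/-! ## The induction: smooth linear sections with ambient basic-open complements -/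

/-- **Smooth linear sections of codimension `k` whose complement is `≤ k` ambient basic opens.**
For `X` smooth projective of dimension `n` over `ℂ` with a closed immersion `ι : X ⟶ ℙᴺ` and
`k + 1 ≤ n` there are a smooth projective `Y` of dimension `n − k`, a closed immersion `f : Y ⟶ X`
and at most `k` linear forms `ℓ_v = Σ v_c x_c` with `X ∖ f(Y) = ⋃_v X ∩ D₊(ℓ_v)`. Induction on
`k`: `k = 0` is `Y = X`; the step cuts `Y` (of dimension `n − k ≥ 2`) by one more smooth
hyperplane section along the composite embedding `Y ⟶ X ⟶ ℙᴺ`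
(`exists_hyperplaneSection_of_embedding`), and
`X ∖ f(Y ∩ V₊(ℓ)) = (X ∖ f(Y)) ∪ (X ∩ D₊(ℓ))` since `f(Y ∩ V₊(ℓ)) = f(Y) ∩ V₊(ℓ)`
(`hyp_ιPP_comp`). [cite: Hartshorne1977, II Thm. 8.18] [cite: VoisinHodgeII2003, §2.1.1] -/
theorem exists_linearSection_basicOpens {N n : ℕ} {X : SchemeOver ℂ} (hX : IsSmoothProjective n X)
    (ι : X ⟶ projectiveSpace N ℂ) [IsClosedImmersion ι.left] :
    ∀ k : ℕ, k + 1 ≤ n →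
      ∃ (Y : SchemeOver ℂ) (f : Y ⟶ X) (vs : Finset (Fin (N + 1) → ℂ)),
        IsSmoothProjective (n - k) Y ∧ IsClosedImmersion f.left ∧ vs.card ≤ k ∧
          (⋃ v ∈ vs, ((Resolution.LinSec.XL (ιPP ι) v : X.left.Opens) : Set X.left)) =
            (Set.range f.left.base)ᶜ := by
  classical
  intro k
  induction k with
  | zero =>
    intro _
    refine ⟨X, 𝟙 X, ∅, hX, ?_, by simp, ?_⟩
    · rw [Over.id_left]
      infer_instance
    · have h0 : (⋃ v ∈ (∅ : Finset (Fin (N + 1) → ℂ)),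
          ((Resolution.LinSec.XL (ιPP ι) v : X.left.Opens) : Set X.left)) = ∅ := by simp
      rw [h0, eq_comm, Set.compl_empty_iff, Set.range_eq_univ]
      exact fun x ↦ ⟨x, rfl⟩
  | succ k ih =>
    intro hk
    obtain ⟨Y, f, vs, hY, hf, hcard, hcov⟩ := ih (by omega)
    -- `dim Y = n - k = m + 1` with `1 ≤ m`
    obtain ⟨m, hm, hmk⟩ : ∃ m, 1 ≤ m ∧ n - k = m + 1 := ⟨n - k - 1, by omega, by omega⟩
    rw [hmk] at hY
    haveI := hf
    haveI : IsClosedImmersion (f ≫ ι).left := by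
      rw [Over.comp_left]
      infer_instance
    -- one more smooth hyperplane section, along the composite embedding `Y ⟶ X ⟶ ℙᴺ`
    obtain ⟨Y', f', v, hY', hf', hr⟩ := exists_hyperplaneSection_of_embedding hY hm (f ≫ ι)
    haveI := hf'
    refine ⟨Y', f' ≫ f, insert v vs, ?_, ?_, ?_, ?_⟩
    · have h : n - (k + 1) = m := by omega
      rw [h]
      exact hY'
    · rw [Over.comp_left]
      infer_instance
    · exact (Finset.card_insert_le _ _).trans (by omega)
    · -- `f(f'(Y')) = f(Y) ∩ V₊(ℓ_v)`, so its complement is `(X ∖ f(Y)) ∪ (X ∩ D₊(ℓ_v))`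
      have hcomp : ((f' ≫ f).left.base : Y'.left → X.left) = f.left.base ∘ f'.left.base := rfl
      have hrange : Set.range (f' ≫ f).left.base =
          Set.range f.left.base ∩ Resolution.LinSec.hyp (ιPP ι) v := by
        rw [hcomp, Set.range_comp, hr, hyp_ιPP_comp, Set.image_preimage_eq_range_inter]
      rw [Finset.set_biUnion_insert, hcov, hrange, Set.compl_inter, Resolution.LinSec.hyp,
        compl_compl]
      exact Set.union_comm _ _

/-! ## The stub -/

/-- **Stub `stub_iteratedSupply` (crux `SectionalSource`, line `birth`) — ITERATED BERTINI SUPPLY: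
SMOOTH LINEAR SECTIONS OF ANY CODIMENSION WITH AMBIENT AFFINE COMPLEMENT PIECES.** For `X` smooth
projective of dimension `n` over `ℂ` and `1 ≤ k ≤ n − 1` there are a smooth projective `Y` of
dimension `n − k`, a closed immersion `f : Y ⟶ X` with `X ∖ f(Y)` non-empty, and a set `s` of at
most `k` AFFINE opens of `X` covering exactly `X ∖ f(Y)`: fix one closed immersion `ι : X ↪ ℙᴺ`,
cut `X` by `k` successive smooth hyperplane sections of the SAME ambient `ℙᴺ`
(`exists_linearSection_basicOpens`), so that `X ∖ f(Y) = ⋃ᵢ X ∩ D₊(ℓᵢ)` with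
`X ∩ D₊(ℓᵢ) = ι⁻¹ D₊(ℓᵢ)` affine (`Resolution.LinSec.isAffineOpen_XL`); the complement is non-empty
since a surjective closed immersion `Y ⟶ X` would be a homeomorphism, forcing `n − k = n`
(`eq_of_isSmoothProjective_of_isHomeomorph`).
[cite: Hartshorne1977, II Thm. 8.18 and II Prop. 2.5] [cite: VoisinHodgeII2003, §2.1.1] -/
theorem stub_iteratedSupply :
    ∀ ⦃n k : ℕ⦄ ⦃X : Literature.AlgebraicGeometry.Motives.SchemeOver ℂ⦄,
      Literature.AlgebraicGeometry.Motives.IsSmoothProjective n X → 1 ≤ k → k + 1 ≤ n →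
      ∃ (Y : Literature.AlgebraicGeometry.Motives.SchemeOver ℂ) (f : Y ⟶ X) (s : Finset X.left.Opens),
        Literature.AlgebraicGeometry.Motives.IsSmoothProjective (n - k) Y ∧
          AlgebraicGeometry.IsClosedImmersion f.left ∧ (∀ U ∈ s, AlgebraicGeometry.IsAffineOpen U) ∧
          (⋃ U ∈ s, (U : Set X.left)) = (Set.range f.left.base)ᶜ ∧ s.card ≤ k ∧
          Set.Nonempty (Set.range f.left.base)ᶜ := by
  classical
  intro n k X hX hk hkn
  obtain ⟨N, ι, hι⟩ := hX.isProjectiveOver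
  haveI := hι
  obtain ⟨Y, f, vs, hY, hf, hcard, hcov⟩ := exists_linearSection_basicOpens hX ι k hkn
  haveI := hf
  refine ⟨Y, f, vs.image (Resolution.LinSec.XL (ιPP ι)), hY, hf, ?_, ?_,
    Finset.card_image_le.trans hcard, ?_⟩
  · -- the pieces are ambient basic opens `ι⁻¹ D₊(ℓ)`, affine
    intro U hU
    obtain ⟨v, -, rfl⟩ := Finset.mem_image.1 hU
    exact Resolution.LinSec.isAffineOpen_XL (ιPP ι) v
  · rw [Finset.set_biUnion_finset_image]
    exact hcov
  · -- a surjective closed immersion `Y ⟶ X` would be a homeomorphism, forcing `n - k = n`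
    rw [Set.nonempty_compl]
    intro huniv
    have h := eq_of_isSmoothProjective_of_isHomeomorph hY hX f
      ((isHomeomorph_iff_isEmbedding_surjective).2
        ⟨f.left.isClosedEmbedding.isEmbedding, Set.range_eq_univ.1 huniv⟩)
    omega

end Summit.HodgeConjecture.HodgeConjecture.Theorems

end
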